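import Summits.QuantumFields.BalabanUV.Beta.FP.TorusCompositeInsertionKernelPacked
import Summits.QuantumFields.BalabanUV.Beta.FP.CompositeKernelFunctionalStep
import Summits.QuantumFields.BalabanUV.Beta.FP.CompositeLinearKernelExpansion
import Summits.QuantumFields.BalabanUV.Beta.CompositeVertexKernelBounds
import Summits.QuantumFields.BalabanUV.Beta.CompositeVertexKernelCongr

/-!
# `BalabanUV.Beta.FP.TorusCompositeVertexJunction` — road «FP» for binder row D1, ROUTE T: **F4 — THE ORDER-1 (C1) Q-JUNCTION FOR THE BRICKS OF RECORD,
# END TO END: OUR composite first-order insertion jet `compIns₁ Lc M lev rs n h` IS, ENTRYWISE on the (multiplier, field) slots, the `h`-weighted torus insertion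
# of the row's PACKED COMPOSITE VERTEX FAMILY `u_n • compVhS ℓ_n 𝓋_n Lc n` over an1's ROOTED bricks `ℓ_n m := linKerAt (toSite (rs (n − m))) Lc`,
# `𝓋_n m := vhKerAt (toSite (rs (n − m))) Lc`, unit `u_n = (∏_{i<n} stepScale d Lc (lev (i+1))) · #box^n`** — no hypothesis beyond `rs k ∈ box`
# (leaf-02 g29 W-7's recipe, an2 g50 W-6 AGREED: R-14 §1 ∘ R-13 `pairing_of_kernel_succ` ∘ R-15 `compLinAvgAt_eq_pow_mul_tsum` ∘ an2's F3 `compVHKer_succ` + F3c congruence + the unit `ring`)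

WHAT.  §1 plumbing (scalars into pairings; the window as a bond `Finset`); §2 **`kernelFunctional_spec`** — a functional `𝓘₁` DEFINED by R-7's
recursion (`h0 ∕ hsucc` by `rfl`) whose value is, at every depth `N`, every `lev` and every in-box `rs`, the kernel form
`𝓘₁ lev rs N H B κ x = u_N · Σ'_u Σ_{κ′} (Σ'_z Σ_l compVHKer ℓ_N 𝓋_N Lc N κ x (l,z) (κ′,u) · B l z) · H κ′ u` (induction on `N`, R-13 read backwards);
§3 **`sum_mul_perZ_dper_compVhS_eq_compIns₁_apply`**: `Σ_b h b · perZ T (dper T (u_n • compVhS ℓ_n 𝓋_n Lc n b.2 b.1)) (Lc^n • x̄) z (inr κ) (inl β) = compIns₁ Lc M lev rs n h (x̄, κ) (z, β)`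
(`T = towerTorus Lc M n`), and the one-bond form = #41d ∕ #42a's `hQF₁ ∕ hQF₁′` at the row's family (every box; order 2 = R-17 `FP.TorusCompositeVertexJunctionTwo`).
[folklore] BY NAME; no `def`, nothing cited, 0 sorry; NO chart; nothing of Bałaban's asserted — that this packed family IS the dressed chart's vertex through the corrector
is an2's (C1) TABLE word (R-D1-g42-4); units per W-4 (2) (an2 A-2 ADOPTED).

HONEST DEPENDENCY (page 1, mandatory): continuum YM on T⁴ ⇐ BetaPertH ∧ nine spine estimates (0/9 proved); BetaPertH ⇐ (D1) ∧ (D4) ∧ CAP+tail;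
G-an2-4 gates asym, D1 and NE2/3/4.  HONEST FRAMING (cell contract, verbatim): «discharging `BetaPertH` makes Bałaban's UV stability UNCONDITIONAL —
a real constructive-QFT result; it is NOT the continuum limit and NOT the Clay problem.»  ABSOLUTE RULE (cell charter, verbatim): «No internally-minted
statement may enter as a cited fact. Every hypothesis is either kernel-proved in this package or a verbatim quotation of a PUBLISHED theorem with page
reference. The manuscript(s) under audit are NOT citable for their own disputed steps — they are the thing under adjudication; programme-internal
(2001/route/tribunal) claims are never citable.»  0 estimates; 0∕4 row-D1 binders (hW, hR, D1Tel, D1Rep); NOT (T-ID), NOT (C1), NOT SDF, NOT D1,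
NOT BetaPertH, NOT continuum, NOT Clay.  D1 formalisation swarm LEAF PROVER 02 (b2b-balaban-beta-d1-formalise-leaf-02 gen 29), 2026-08-23.  No existing file touched.
-/

noncomputable section

open scoped BigOperators

namespace Summit.QuantumFields.BalabanUV.Beta.FP.TorusCompositeVertexJunction

open Finset
open Literature.MathematicalPhysics.QuantumFieldTheory
open Literature.MathematicalPhysics.QuantumFieldTheory.Balaban1983to89
open Literature.MathematicalPhysics.QuantumFieldTheory.Balaban1983to89.Beta
open B6Lemma24Torus (pbox)
open ExpKernelCalculus (MKer shiftK)
open AffineAveraging (Site Form1 box toSite)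
open AveragingContoursRooted (linAvgAt)
open AveragingHessianKernels (Bond Near packVH)
open AveragingHessianKernelsRooted (linKerAt vhKerAt vhKerAt_eq_zero_left vhKerAt_eq_zero_right linKerAt_eq_zero)
open OneStepResolventKernel (Fib)
open Summit.QuantumFields.BalabanUV.Beta.BorderedHessian (stepScale stepScale_ne_zero)
open Summit.QuantumFields.BalabanUV.Beta.FP.KernelPeriodisationFib (perZ)
open Summit.QuantumFields.BalabanUV.Beta.FP.KernelPeriodisationFibLoc (dper)
open Summit.QuantumFields.BalabanUV.Beta.FP.TorusGaugeCovariancePairing (wrapPt)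
open Summit.QuantumFields.BalabanUV.Beta.FP.TorusCompositeObjects (towerTorus)
open Summit.QuantumFields.BalabanUV.Beta.CompositeAveragingCoarseExact (compLinAvgAt)
open Summit.QuantumFields.BalabanUV.Beta.FP.TorusCompositeCovarianceOne (compIns₁ prod_stepScale_mul_card_ne_zero')
open Summit.QuantumFields.BalabanUV.Beta.FP.TorusCompositeCovarianceTwo (card_box_cast)
open Summit.QuantumFields.BalabanUV.Beta.CompositeVertexKernelRec (offs near_iff_exists_offs winF wid compLinKer compVHKer compVhS compLinKer_zero compLinKer_succ
  compVHKer_zero compVHKer_succ compLinKer_eq_zero compVHKer_eq_zero_left compVHKer_eq_zero_right compLinKer_congr compVHKer_congr compVhS_rooted_translate)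
open Summit.QuantumFields.BalabanUV.Beta.FP.CompositeKernelFunctionalStep (tsum_sum_eq_finset_sum pairing_of_kernel_succ)
open Summit.QuantumFields.BalabanUV.Beta.FP.CompositeLinearKernelExpansion (linAvgAt_eq_pow_mul_window_sum compLinAvgAt_eq_pow_mul_tsum)
open Summit.QuantumFields.BalabanUV.Beta.FP.TorusCompositeInsertionKernelPacked (sum_mul_perZ_dper_packVH_eq_compIns₁_apply perZ_dper_packVH_eq_compIns₁_apply_single)

variable {d : ℕ} (Lc : ℕ) [NeZero Lc]

/-! ## §1 Plumbing -/

omit [NeZero Lc] in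
/-- [folklore] a scalar moves inside the border pairing. -/
theorem mul_pairing_eq (c : ℝ) (K : Bond (d + 1) → Bond (d + 1) → ℝ) (B H : Form1 (d + 1) ℝ) :
    c * (∑' u : Site (d + 1), ∑ κ' : Fin (d + 1), (∑' z : Site (d + 1), ∑ l : Fin (d + 1), K (l, z) (κ', u) * B l z) * H κ' u)
      = ∑' u : Site (d + 1), ∑ κ' : Fin (d + 1), (∑' z : Site (d + 1), ∑ l : Fin (d + 1), (c * K (l, z) (κ', u)) * B l z) * H κ' u := by
  rw [← tsum_mul_left]
  refine tsum_congr fun u => ?_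
  rw [Finset.mul_sum]
  refine Finset.sum_congr rfl fun κ' _ => ?_
  rw [← mul_assoc, ← tsum_mul_left]
  refine congrArg (fun t : ℝ => t * _) (tsum_congr fun z => ?_)
  rw [Finset.mul_sum]
  exact Finset.sum_congr rfl fun l _ => by rw [mul_assoc]

omit [NeZero Lc] in
/-- [folklore] a bond outside the one-step bond window `P` of the coarse site `x` is outside an1's `Near` window. -/
theorem not_near_of_not_mem_window (x : Site (d + 1)) {P : Finset (Bond (d + 1))}
    (hP : P = ((Finset.univ : Finset (Fin (d + 1))) ×ˢ offs Lc).image (fun p : Fin (d + 1) × Site (d + 1) => ((p.1, (Lc : ℤ) • x + p.2) : Bond (d + 1))))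
    {g : Bond (d + 1)} (hg : g ∉ P) : ¬ Near Lc x g.2 := fun h => by
  obtain ⟨e, he, hge⟩ := near_iff_exists_offs.1 h
  exact hg (by rw [hP]; exact Finset.mem_image.2 ⟨(g.1, e), Finset.mem_product.2 ⟨Finset.mem_univ _, he⟩, Prod.ext rfl hge.symm⟩)

omit [NeZero Lc] in
/-- [folklore] a sum over the bond window is the double sum over directions and offsets. -/
theorem sum_window_eq (x : Site (d + 1)) {P : Finset (Bond (d + 1))}
    (hP : P = ((Finset.univ : Finset (Fin (d + 1))) ×ˢ offs Lc).image (fun p : Fin (d + 1) × Site (d + 1) => ((p.1, (Lc : ℤ) • x + p.2) : Bond (d + 1))))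
    (F : Bond (d + 1) → ℝ) :
    ∑ g ∈ P, F g = ∑ κ : Fin (d + 1), ∑ e ∈ offs Lc, F (κ, (Lc : ℤ) • x + e) := by
  have hinj : ∀ p ∈ (Finset.univ : Finset (Fin (d + 1))) ×ˢ offs Lc, ∀ q ∈ (Finset.univ : Finset (Fin (d + 1))) ×ˢ offs Lc,
      ((p.1, (Lc : ℤ) • x + p.2) : Bond (d + 1)) = (q.1, (Lc : ℤ) • x + q.2) → p = q := by
    rintro ⟨κ, e⟩ _ ⟨κ', e'⟩ _ h
    obtain ⟨h1, h2⟩ := Prod.mk.inj h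
    exact Prod.ext h1 (add_left_cancel h2)
  rw [hP, Finset.sum_image hinj, Finset.sum_product]

omit [NeZero Lc] in
/-- [folklore] the tower's lower normalisation product is the step-scale product times `#box^n`. -/
theorem sigma_eq (lev : ℕ → ℕ) (n : ℕ) :
    (∏ i ∈ range n, (stepScale d Lc (lev (i + 1 + 1)) * ((box (d + 1) Lc).card : ℝ)))
      = (∏ i ∈ range n, stepScale d Lc (lev (i + 1 + 1))) * ((box (d + 1) Lc).card : ℝ) ^ n := by
  rw [Finset.prod_mul_distrib, Finset.prod_const, Finset.card_range]

/-! ## §2 The kernel functional of the bricks of record: OUR chain rule's clauses AND the kernel identity -/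

/-- [folklore] **`kernelFunctional_spec` — A FUNCTIONAL `𝓘₁` SATISFYING R-7's CHAIN RULE (`h0`, `hsucc`, by `rfl`: it is DEFINED by that recursion) WHOSE VALUE AT
EVERY DEPTH `n`, FOR EVERY `lev` AND EVERY IN-BOX `rs`, IS THE PAIRING AGAINST THE ROW's COMPOSITE VERTEX KERNEL OVER an1's ROOTED BRICKS `rs (n − m)` with unit
`u_n = (∏_{i<n} stepScale d Lc (lev (i+1))) · #box^n`** (universal in `n, lev, rs` so that the order-2 twin can read `𝓘₁` below the top)
(W-7's recipe, by induction on `n`: R-13 `pairing_of_kernel_succ` at an2's top peel `compVHKer_succ`, R-15's two kernel expansions for `hAf ∕ hCf`, F3c's congruence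
for the brick lists `rs (n+1−m)` vs `rs (n−m+1)` below the top, an1's brick windows for `hvh ∕ ha`, an2's windows for `hc ∕ hKz ∕ hKu`, and the unit identity
`u_{n+1} = θ_n · u′_n ² = stepScale d Lc (lev 1) · #box · u′_n`, `#box = Lc^{d+1}`). -/
theorem kernelFunctional_spec :
    ∃ 𝓘 : (ℕ → ℕ) → (ℕ → (Fin (d + 1) → ℕ)) → ℕ → Form1 (d + 1) ℝ → Form1 (d + 1) ℝ → Form1 (d + 1) ℝ,
      (∀ (lev : ℕ → ℕ) (rs : ℕ → (Fin (d + 1) → ℕ)) (H B : Form1 (d + 1) ℝ), 𝓘 lev rs 0 H B = 0) ∧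
      (∀ (lev : ℕ → ℕ) (rs : ℕ → (Fin (d + 1) → ℕ)) (n : ℕ) (H B : Form1 (d + 1) ℝ) (κ : Fin (d + 1)) (x : Site (d + 1)),
        𝓘 lev rs (n + 1) H B κ x
          = (((Lc : ℝ) ^ (d + 1) * stepScale d Lc (lev 1)) * (∏ i ∈ Finset.range n, (stepScale d Lc (lev (i + 1 + 1)) * ((box (d + 1) Lc).card : ℝ)))⁻¹) *
              (∑' u : Site (d + 1), ∑ κ' : Fin (d + 1),
                (∑' z : Site (d + 1), ∑ l : Fin (d + 1), vhKerAt (toSite (rs 1)) Lc κ x (l, z) (κ', u) *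
                  ((∏ i ∈ Finset.range n, stepScale d Lc (lev (i + 1 + 1))) * compLinAvgAt (fun i => rs (n - i + 1)) Lc n B l z)) *
                ((∏ i ∈ Finset.range n, stepScale d Lc (lev (i + 1 + 1))) * compLinAvgAt (fun i => rs (n - i + 1)) Lc n H κ' u))
            + stepScale d Lc (lev 1) * linAvgAt (toSite (rs 1)) (𝓘 (fun k => lev (k + 1)) (fun k => rs (k + 1)) n H B) Lc κ x) ∧
      (∀ (n : ℕ) (lev : ℕ → ℕ) (rs : ℕ → (Fin (d + 1) → ℕ)), (∀ k, rs k ∈ box (d + 1) Lc) →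
        ∀ (H B : Form1 (d + 1) ℝ) (κ : Fin (d + 1)) (x : Site (d + 1)), 𝓘 lev rs n H B κ x
          = ((∏ i ∈ range n, stepScale d Lc (lev (i + 1))) * ((box (d + 1) Lc).card : ℝ) ^ n) *
              ∑' u : Site (d + 1), ∑ κ' : Fin (d + 1), (∑' z : Site (d + 1), ∑ l : Fin (d + 1),
                compVHKer (fun m => linKerAt (toSite (rs (n - m))) Lc) (fun m => vhKerAt (toSite (rs (n - m))) Lc) Lc n κ x (l, z) (κ', u) * B l z) * H κ' u) := by
  classical
  have hLc : 1 ≤ Lc := Nat.one_le_iff_ne_zero.mpr (NeZero.ne Lc)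
  -- the step of the recursion, abstracted once (`S n ih lev rs H B κ x` = R-7's `hsucc` right-hand side with `ih` for the lower functional)
  obtain ⟨S, hS⟩ : ∃ S : ℕ → ((ℕ → ℕ) → (ℕ → (Fin (d + 1) → ℕ)) → Form1 (d + 1) ℝ → Form1 (d + 1) ℝ → Form1 (d + 1) ℝ) →
      (ℕ → ℕ) → (ℕ → (Fin (d + 1) → ℕ)) → Form1 (d + 1) ℝ → Form1 (d + 1) ℝ → Form1 (d + 1) ℝ,
      ∀ (n : ℕ) (ih : (ℕ → ℕ) → (ℕ → (Fin (d + 1) → ℕ)) → Form1 (d + 1) ℝ → Form1 (d + 1) ℝ → Form1 (d + 1) ℝ)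
        (lev : ℕ → ℕ) (rs : ℕ → (Fin (d + 1) → ℕ)) (H B : Form1 (d + 1) ℝ) (κ : Fin (d + 1)) (x : Site (d + 1)),
        S n ih lev rs H B κ x
          = (((Lc : ℝ) ^ (d + 1) * stepScale d Lc (lev 1)) * (∏ i ∈ Finset.range n, (stepScale d Lc (lev (i + 1 + 1)) * ((box (d + 1) Lc).card : ℝ)))⁻¹) *
              (∑' u : Site (d + 1), ∑ κ' : Fin (d + 1),
                (∑' z : Site (d + 1), ∑ l : Fin (d + 1), vhKerAt (toSite (rs 1)) Lc κ x (l, z) (κ', u) *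
                  ((∏ i ∈ Finset.range n, stepScale d Lc (lev (i + 1 + 1))) * compLinAvgAt (fun i => rs (n - i + 1)) Lc n B l z)) *
                ((∏ i ∈ Finset.range n, stepScale d Lc (lev (i + 1 + 1))) * compLinAvgAt (fun i => rs (n - i + 1)) Lc n H κ' u))
            + stepScale d Lc (lev 1) * linAvgAt (toSite (rs 1)) (ih (fun k => lev (k + 1)) (fun k => rs (k + 1)) H B) Lc κ x :=
    ⟨_, fun _ _ _ _ _ _ _ _ => rfl⟩
  refine ⟨fun lev rs N H B => Nat.rec (motive := fun _ => (ℕ → ℕ) → (ℕ → (Fin (d + 1) → ℕ)) → Form1 (d + 1) ℝ → Form1 (d + 1) ℝ → Form1 (d + 1) ℝ)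
      (fun _ _ _ _ => 0) S N lev rs H B, fun _ _ _ _ => rfl, fun lev rs n H B κ x => hS n _ lev rs H B κ x, ?_⟩
  intro n
  induction n with
  | zero =>
      intro lev rs _ H B κ x
      simp only [Nat.rec_zero, Pi.zero_apply, compVHKer_zero, zero_mul, Finset.sum_const_zero, tsum_zero, mul_zero]
  | succ n ih =>
      intro lev rs hrs H B κ x
      -- the lower functional, by induction (bricks `rs (n − m + 1)`)
      have hih : ∀ H B : Form1 (d + 1) ℝ,
          (Nat.rec (motive := fun _ => (ℕ → ℕ) → (ℕ → (Fin (d + 1) → ℕ)) → Form1 (d + 1) ℝ → Form1 (d + 1) ℝ → Form1 (d + 1) ℝ)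
              (fun _ _ _ _ => 0) S n (fun k => lev (k + 1)) (fun k => rs (k + 1)) H B : Form1 (d + 1) ℝ)
            = fun κ₀ y => ((∏ i ∈ range n, stepScale d Lc (lev (i + 1 + 1))) * ((box (d + 1) Lc).card : ℝ) ^ n) *
                ∑' u : Site (d + 1), ∑ κ' : Fin (d + 1), (∑' z : Site (d + 1), ∑ l : Fin (d + 1),
                  compVHKer (fun m => linKerAt (toSite (rs (n - m + 1))) Lc) (fun m => vhKerAt (toSite (rs (n - m + 1))) Lc) Lc n κ₀ y (l, z) (κ', u)
                    * B l z) * H κ' u :=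
        fun H B => funext fun κ₀ => funext fun y => ih (fun k => lev (k + 1)) (fun k => rs (k + 1)) (fun k => hrs (k + 1)) H B κ₀ y
      -- units
      have hu : (∏ i ∈ range (n + 1), stepScale d Lc (lev (i + 1))) * ((box (d + 1) Lc).card : ℝ) ^ (n + 1)
          = stepScale d Lc (lev 1) * (∏ i ∈ range n, stepScale d Lc (lev (i + 1 + 1))) * ((box (d + 1) Lc).card : ℝ) ^ n * ((box (d + 1) Lc).card : ℝ) := by
        rw [Finset.prod_range_succ', Nat.zero_add, pow_succ]; ring
      have h0' : (∏ i ∈ range n, stepScale d Lc (lev (i + 1 + 1))) * ((Lc : ℝ) ^ (d + 1)) ^ n ≠ 0 := by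
        rw [← card_box_cast Lc, ← sigma_eq Lc lev n]
        exact prod_stepScale_mul_card_ne_zero' Lc ⟨rs 0, hrs 0⟩ (fun i => lev (i + 1 + 1)) n
      have hθ : (Lc : ℝ) ^ (d + 1) * stepScale d Lc (lev 1) * ((∏ i ∈ range n, stepScale d Lc (lev (i + 1 + 1))) * ((Lc : ℝ) ^ (d + 1)) ^ n)⁻¹
            * ((∏ i ∈ range n, stepScale d Lc (lev (i + 1 + 1))) * ((Lc : ℝ) ^ (d + 1)) ^ n
                * ((∏ i ∈ range n, stepScale d Lc (lev (i + 1 + 1))) * ((Lc : ℝ) ^ (d + 1)) ^ n))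
          = stepScale d Lc (lev 1) * (∏ i ∈ range n, stepScale d Lc (lev (i + 1 + 1))) * ((Lc : ℝ) ^ (d + 1)) ^ n * (Lc : ℝ) ^ (d + 1) := by
        rw [mul_assoc ((Lc : ℝ) ^ (d + 1) * stepScale d Lc (lev 1)), inv_mul_cancel_left₀ h0']; ring
      -- F3c: below the top, the brick lists `rs (n + 1 − m)` and `rs (n − m + 1)` agree
      have hc : ∀ b g : Bond (d + 1), compLinKer (fun m => linKerAt (toSite (rs (n + 1 - m))) Lc) Lc n b g
          = compLinKer (fun m => linKerAt (toSite (rs (n - m + 1))) Lc) Lc n b g := fun b g =>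
        compLinKer_congr n (fun m hm μ y g => by simp only [show n + 1 - m = n - m + 1 by omega]) b g
      have hK : ∀ (μ : Fin (d + 1)) (y : Site (d + 1)) (b b' : Bond (d + 1)),
          compVHKer (fun m => linKerAt (toSite (rs (n + 1 - m))) Lc) (fun m => vhKerAt (toSite (rs (n + 1 - m))) Lc) Lc n μ y b b'
            = compVHKer (fun m => linKerAt (toSite (rs (n - m + 1))) Lc) (fun m => vhKerAt (toSite (rs (n - m + 1))) Lc) Lc n μ y b b' :=
        fun μ y b b' => compVHKer_congr n (fun m hm μ y g => by simp only [show n + 1 - m = n - m + 1 by omega])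
          (fun m hm μ y g g' => by simp only [show n + 1 - m = n - m + 1 by omega]) μ y b b'
      -- the bond window of the coarse site `x`
      obtain ⟨P, hP⟩ : ∃ P : Finset (Bond (d + 1)),
          P = ((Finset.univ : Finset (Fin (d + 1))) ×ˢ offs Lc).image (fun p : Fin (d + 1) × Site (d + 1) => ((p.1, (Lc : ℤ) • x + p.2) : Bond (d + 1))) :=
        ⟨_, rfl⟩
      -- unfold the recursion once, put the lower functional in kernel form, normalise the units
      refine (hS n (Nat.rec (motive := fun _ => (ℕ → ℕ) → (ℕ → (Fin (d + 1) → ℕ)) → Form1 (d + 1) ℝ → Form1 (d + 1) ℝ → Form1 (d + 1) ℝ)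
        (fun _ _ _ _ => 0) S n) lev rs H B κ x).trans ?_
      rw [hih H B, hu, mul_pairing_eq (stepScale d Lc (lev 1) * (∏ i ∈ range n, stepScale d Lc (lev (i + 1 + 1))) * ((box (d + 1) Lc).card : ℝ) ^ n
        * ((box (d + 1) Lc).card : ℝ)), sigma_eq Lc lev n, card_box_cast]
      -- R-13's abstract step, read backwards
      refine (pairing_of_kernel_succ P
        ((Lc : ℝ) ^ (d + 1) * stepScale d Lc (lev 1) * ((∏ i ∈ range n, stepScale d Lc (lev (i + 1 + 1))) * ((Lc : ℝ) ^ (d + 1)) ^ n)⁻¹)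
        (stepScale d Lc (lev 1)) κ x (vhKerAt (toSite (rs 1)) Lc κ x)
        (fun g g' hg => hg.elim (fun hg => vhKerAt_eq_zero_left (hrs 1) (not_near_of_not_mem_window Lc x hP hg) g')
          fun hg' => vhKerAt_eq_zero_right (hrs 1) g (not_near_of_not_mem_window Lc x hP hg'))
        (fun g => (Lc : ℝ) ^ (d + 1) * linKerAt (toSite (rs 1)) Lc κ x g)
        (fun g hg => mul_eq_zero_of_right _ (linKerAt_eq_zero (hrs 1) (not_near_of_not_mem_window Lc x hP hg)))
        (fun F => linAvgAt (toSite (rs 1)) F Lc) (fun F => ?_)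
        (fun g f => ((∏ i ∈ range n, stepScale d Lc (lev (i + 1 + 1))) * ((Lc : ℝ) ^ (d + 1)) ^ n)
          * compLinKer (fun m => linKerAt (toSite (rs (n - m + 1))) Lc) Lc n f g)
        (fun g => winF (Lc ^ n) (wid Lc n) g.2) (fun g m w hw => mul_eq_zero_of_right _ (compLinKer_eq_zero n (f := (m, w)) hw))
        (fun B' => fun l z => (∏ i ∈ range n, stepScale d Lc (lev (i + 1 + 1))) * compLinAvgAt (fun i => rs (n - i + 1)) Lc n B' l z) (fun B' g => ?_)
        (fun g f f' => ((∏ i ∈ range n, stepScale d Lc (lev (i + 1 + 1))) * ((Lc : ℝ) ^ (d + 1)) ^ n)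
          * compVHKer (fun m => linKerAt (toSite (rs (n - m + 1))) Lc) (fun m => vhKerAt (toSite (rs (n - m + 1))) Lc) Lc n g.1 g.2 f f')
        (fun g => winF (Lc ^ n) (wid Lc n) g.2) (fun g l f' z hz => mul_eq_zero_of_right _ (compVHKer_eq_zero_left n (f := (l, z)) f' hz))
        (fun g f κ' u hu => mul_eq_zero_of_right _ (compVHKer_eq_zero_right n f (f' := (κ', u)) hu))
        (fun H' B' => fun κ₀ y => ((∏ i ∈ range n, stepScale d Lc (lev (i + 1 + 1))) * ((Lc : ℝ) ^ (d + 1)) ^ n) *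
          ∑' u : Site (d + 1), ∑ κ' : Fin (d + 1), (∑' z : Site (d + 1), ∑ l : Fin (d + 1),
            compVHKer (fun m => linKerAt (toSite (rs (n - m + 1))) Lc) (fun m => vhKerAt (toSite (rs (n - m + 1))) Lc) Lc n κ₀ y (l, z) (κ', u) * B' l z) * H' κ' u)
        (fun H' B' g => mul_pairing_eq _
          (compVHKer (fun m => linKerAt (toSite (rs (n - m + 1))) Lc) (fun m => vhKerAt (toSite (rs (n - m + 1))) Lc) Lc n g.1 g.2) B' H')
        (fun f f' => (stepScale d Lc (lev 1) * (∏ i ∈ range n, stepScale d Lc (lev (i + 1 + 1))) * ((Lc : ℝ) ^ (d + 1)) ^ n * (Lc : ℝ) ^ (d + 1))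
          * compVHKer (fun m => linKerAt (toSite (rs (n + 1 - m))) Lc) (fun m => vhKerAt (toSite (rs (n + 1 - m))) Lc) Lc (n + 1) κ x f f')
        (fun f f' => ?_) B H).symm
      · -- `hAf`: R-15 §1 at the window, read as a bond `tsum`
        have h1 : (∑' x₁ : Site (d + 1), ∑ κ₁ : Fin (d + 1), ((Lc : ℝ) ^ (d + 1) * linKerAt (toSite (rs 1)) Lc κ x (κ₁, x₁)) * F κ₁ x₁)
            = ∑ p ∈ P, ((Lc : ℝ) ^ (d + 1) * linKerAt (toSite (rs 1)) Lc κ x p) * F p.1 p.2 :=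
          tsum_sum_eq_finset_sum P (fun g => ((Lc : ℝ) ^ (d + 1) * linKerAt (toSite (rs 1)) Lc κ x g) * F g.1 g.2)
            fun g hg => mul_eq_zero_of_left (mul_eq_zero_of_right _ (linKerAt_eq_zero (hrs 1) (not_near_of_not_mem_window Lc x hP hg))) _
        rw [h1, sum_window_eq Lc x hP, linAvgAt_eq_pow_mul_window_sum hLc (hrs 1) (offs Lc) (fun y w h => near_iff_exists_offs.1 h) F κ x]
        simp only [Finset.mul_sum, mul_assoc]
      · -- `hCf`: R-15 §2 for the lower storey's bricks
        rw [compLinAvgAt_eq_pow_mul_tsum hLc (fun i => rs (n - i + 1)) (fun k => hrs _) (offs Lc) (fun y w h => near_iff_exists_offs.1 h)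
          (compLinKer (fun m => linKerAt (toSite (rs (n - m + 1))) Lc) Lc) (fun f g => compLinKer_zero f g) (fun m f g => compLinKer_succ m f g)
          (fun m g => winF (Lc ^ m) (wid Lc m) g.2) (fun m f g h => compLinKer_eq_zero m h) n B' g, ← mul_assoc, ← tsum_mul_left]
        refine tsum_congr fun w => ?_
        rw [Finset.mul_sum]
        exact Finset.sum_congr rfl fun m _ => by ring
      · -- `h𝒦′`: an2's top peel + F3c below the top + the units
        rw [compVHKer_succ, Nat.add_sub_cancel_left, mul_add]
        simp only [sum_window_eq Lc x hP, hc, hK, Finset.mul_sum]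
        congr 1
        · refine Finset.sum_congr rfl fun κ₁ _ => Finset.sum_congr rfl fun e _ => Finset.sum_congr rfl fun κ₂ _ =>
            Finset.sum_congr rfl fun e' _ => ?_
          rw [← hθ]; ring
        · refine Finset.sum_congr rfl fun κ₁ _ => Finset.sum_congr rfl fun e _ => ?_
          ring

/-! ## §3 F4: the order-1 Q-junction for the bricks of record, every box -/

section Junction

variable (n : ℕ) (M : Fin (d + 1) → ℕ) [∀ μ, NeZero (M μ)] (lev : ℕ → ℕ) (rs : ℕ → (Fin (d + 1) → ℕ)) (hrs : ∀ k, rs k ∈ box (d + 1) Lc)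
include hrs

/-- [folklore] **F4 — THE (C1) Q-JUNCTION, ORDER 1, FOR THE ROW's PACKED COMPOSITE VERTEX FAMILY OVER an1's ROOTED BRICKS** (R-14 §1 at `K := compVHKer ℓ_n 𝓋_n Lc n`,
`cu := u_n`, with `kernelFunctional_spec`'s functional, an2's windows `compVHKer_eq_zero_left ∕ _right` and block covariance `compVhS_rooted_translate`):
`Σ_b h b · perZ T (dper T (u_n • compVhS ℓ_n 𝓋_n Lc n b.2 b.1)) (Lc^n • x̄) z (inr κ) (inl β) = compIns₁ Lc M lev rs n h (x̄, κ) (z, β)`, `T = towerTorus Lc M n`, every box. -/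
theorem sum_mul_perZ_dper_compVhS_eq_compIns₁_apply
    (h : ↥(pbox (towerTorus Lc M n)) × Fin (d + 1) → ℝ) (x : ↥(pbox M)) (κ : Fin (d + 1)) (z : ↥(pbox (towerTorus Lc M n))) (β : Fin (d + 1)) :
    ∑ b : ↥(pbox (towerTorus Lc M n)) × Fin (d + 1), h b *
        perZ (towerTorus Lc M n) (dper (towerTorus Lc M n)
          ((((∏ i ∈ range n, stepScale d Lc (lev (i + 1))) * ((box (d + 1) Lc).card : ℝ) ^ n)) •
            compVhS (fun m => linKerAt (toSite (rs (n - m))) Lc) (fun m => vhKerAt (toSite (rs (n - m))) Lc) Lc n b.2 (b.1 : Site (d + 1))))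
          ((((Lc ^ n : ℕ) : ℤ)) • (x : Site (d + 1))) (z : Site (d + 1)) (Sum.inr κ) (Sum.inl β)
      = compIns₁ Lc M lev rs n h (x, κ) (z, β) := by
  obtain ⟨𝓘, h0, hsucc, h𝓘⟩ := kernelFunctional_spec (d := d) Lc
  exact sum_mul_perZ_dper_packVH_eq_compIns₁_apply Lc 𝓘 h0 hsucc n M lev rs hrs
    (compVHKer (fun m => linKerAt (toSite (rs (n - m))) Lc) (fun m => vhKerAt (toSite (rs (n - m))) Lc) Lc n)
    ((∏ i ∈ range n, stepScale d Lc (lev (i + 1))) * ((box (d + 1) Lc).card : ℝ) ^ n) (winF (Lc ^ n) (wid Lc n))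
    (fun μ y α κ' u w hw => compVHKer_eq_zero_left n (f := (α, w)) (κ', u) hw)
    (fun μ y α w κ' u hu => compVHKer_eq_zero_right n (α, w) (f' := (κ', u)) hu)
    (fun κ' u t => compVhS_rooted_translate (r := fun m => rs (n - m)) (Nat.one_le_iff_ne_zero.mpr (NeZero.ne Lc)) n κ' u t)
    (h𝓘 n lev rs hrs) h x κ z β

/-- [folklore] **F4, ONE-BOND FORM = #41d ∕ #42a's `hQF₁ ∕ hQF₁′` AT THE ROW's FAMILY** (R-14 §1 single-bond form): for every finest bond `(κ′, u)`,
`perZ T (dper T (u_n • compVhS ℓ_n 𝓋_n Lc n κ′ u)) (Lc^n • x̄) z (inr κ) (inl β) = compIns₁ Lc M lev rs n (𝟙_{(wrapPt T u, κ′)}) (x̄, κ) (z, β)`. -/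
theorem perZ_dper_compVhS_eq_compIns₁_apply_single
    (κ' : Fin (d + 1)) (u : Site (d + 1)) (x : ↥(pbox M)) (κ : Fin (d + 1)) (z : ↥(pbox (towerTorus Lc M n))) (β : Fin (d + 1)) :
    perZ (towerTorus Lc M n) (dper (towerTorus Lc M n)
        ((((∏ i ∈ range n, stepScale d Lc (lev (i + 1))) * ((box (d + 1) Lc).card : ℝ) ^ n)) •
          compVhS (fun m => linKerAt (toSite (rs (n - m))) Lc) (fun m => vhKerAt (toSite (rs (n - m))) Lc) Lc n κ' u))
        ((((Lc ^ n : ℕ) : ℤ)) • (x : Site (d + 1))) (z : Site (d + 1)) (Sum.inr κ) (Sum.inl β)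
      = compIns₁ Lc M lev rs n (fun b => if b = (wrapPt (towerTorus Lc M n) u, κ') then 1 else 0) (x, κ) (z, β) := by
  obtain ⟨𝓘, h0, hsucc, h𝓘⟩ := kernelFunctional_spec (d := d) Lc
  exact perZ_dper_packVH_eq_compIns₁_apply_single Lc 𝓘 h0 hsucc n M lev rs hrs
    (compVHKer (fun m => linKerAt (toSite (rs (n - m))) Lc) (fun m => vhKerAt (toSite (rs (n - m))) Lc) Lc n)
    ((∏ i ∈ range n, stepScale d Lc (lev (i + 1))) * ((box (d + 1) Lc).card : ℝ) ^ n) (winF (Lc ^ n) (wid Lc n))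
    (fun μ y α κ' u w hw => compVHKer_eq_zero_left n (f := (α, w)) (κ', u) hw)
    (fun μ y α w κ' u hu => compVHKer_eq_zero_right n (α, w) (f' := (κ', u)) hu)
    (fun κ' u t => compVhS_rooted_translate (r := fun m => rs (n - m)) (Nat.one_le_iff_ne_zero.mpr (NeZero.ne Lc)) n κ' u t)
    (h𝓘 n lev rs hrs) κ' u x κ z β

end Junction

end Summit.QuantumFields.BalabanUV.Beta.FP.TorusCompositeVertexJunction

end
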